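import Mathlib.Analysis.Calculus.FDeriv.Extend
import Mathlib.MeasureTheory.Integral.IntegralEqImproper
import Literature.Probability.RandomPlanarGeometry.SLEKappaRho
import Literature.Probability.RandomPlanarGeometry.LoewnerHullCapacity
import Literature.Probability.RandomPlanarGeometry.ObservableShortTime
import HarnessLib

/-!
# [LSW] Lemma 8.3 (4) discharged: `K_∞` of SLE(κ, ρ) is almost surely unbounded

Proof-only complement to `SLEKappaRho` (no definitions, no named facts): the named fact
`Literature.Probability.RandomPlanarGeometry.SLEKappaRho.not_isBounded_hullUnion` of that file,

* G. F. Lawler, O. Schramm, W. Werner, *Conformal restriction: the chordal case*, J. Amer. Math.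
  Soc. **16** (2003) 917–955, arXiv:math/0209343 (**[LSW]**), Lemma 8.3 (4) (p. 36): "Let `κ > 0`,
  `ρ > −2` […] `K_∞ := ⋃_{t>0} K_t`. […] (4) `K_∞` is a.s. unbounded", with its printed proof
  "Statement 4 easily follows from 1, for example. One could also use the fact that the
  half-plane capacity of `K_t` is `2t`",

is PROVED here unconditionally (`SLEKappaRho.not_isBounded_hullUnion_holds`), for every SLE(κ, ρ)
driving pair `(O, W)` of the tree (`IsSLEKappaRhoPair`: `W = √κ X + O`, `X` a `d`-dimensional
Bessel process driven by the canonical Brownian motion, `O_t = −2 ∫₀ᵗ du/(√κ X_u)` as an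
interval integral).

The printed (second) argument is the tree's `Loewner.not_isBounded_iUnion_hull`
(`LoewnerHullCapacity`: `hcap(K_t) = 2t` for the chain of every CONTINUOUS driving function,
so `⋃_t K_t` fits in no disc). It applies on every sample path `ω` on which `t ↦ W_t(ω)` is
continuous, in particular whenever `u ↦ 1/Z_u(ω)` is locally integrable ([LSW]: "Note also that
`∫₀ᵗ du/Z_u = (Z_t − √κ B_t)/(ρ + 2) < ∞` for all `t ≥ 0`"; the paths of `X = √Z` are a.s.
continuous because `Z` is an Itô process). The tree's `O_t` is the interval integral with
Mathlib's junk value `0` where `1/Z(ω)` is not integrable on `[0, t]`, and the previously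
available discharge (`SLEKappaRho.not_isBounded_hullUnion_of_integral_inv_eq`,
`SLEKappaRhoRestrictionProofs`) was conditional on the named fact `SLEKappaRho.integral_inv_eq`
excluding such paths almost surely. This file removes the condition by analysing the exceptional
paths directly, with the tree's definitions of the Loewner flow (`LoewnerChain`): if `1/Z(ω)` is
not integrable on some `[0, t]`, let `t⋆` be the infimum of such `t`; then `O(ω) = 0` after `t⋆`
and either

* `1/Z(ω)` is not integrable on `[0, t⋆]`: then `∫₀ˢ du/Z_u ↑ +∞` as `s ↑ t⋆`
  (`tendsto_setIntegral_Ioc_atTop`, from Mathlib's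
  `integrableOn_Ioc_of_intervalIntegral_norm_bounded_right`), the driving function tends to `−∞`
  at `t⋆−`, and NO solution of the Loewner equation lives past `t⋆`
  (`Loewner.IsSolution.not_coe_lt_of_tendsto_abs_driving`: its velocity `2/(g − W)` would tend
  to `0` at `t⋆−`, forcing `ġ(t⋆) = 0` by the one-sided extension theorem for derivatives,
  Mathlib's `hasDerivWithinAt_Iic_of_tendsto_deriv`, whereas `ġ(t⋆) = 2/(g(t⋆) − W_{t⋆}) ≠ 0`);
* or it is, with `∫₀^{t⋆} du/Z_u = 0`: then `O(ω) ≡ 0` and `W(ω) = √κ X(ω)` is continuous;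
* or it is, with `∫₀^{t⋆} du/Z_u > 0`: then `W(ω)` jumps to the right of `t⋆` by
  `+2∫₀^{t⋆} du/Z_u`, and no solution started at `z` with `(im z)² > 4t⋆` lives past `t⋆`
  (`Loewner.IsSolution.not_coe_lt_of_tendsto_driving`: along any solution
  `(im g_t)² ≥ (im z)² − 4t` — the tree's `Loewner.IsSolution.im_sq_sub_le`
  (`ObservableShortTime`), no continuity needed — so
  `g(t⋆) ∉ ℝ`, and the right limit `2/(g(t⋆) − W_{t⋆+})` of the velocity would have to be
  `ġ(t⋆) = 2/(g(t⋆) − W_{t⋆})`, Mathlib's `hasDerivWithinAt_Ici_of_tendsto_deriv`).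

In the first and third cases every point `z ∈ ℍ` with `(im z)² > 4t⋆` is swallowed by time
`t⋆` (`T_z ≤ t⋆`), so `K_{t⋆} ⊇ {im z > 2√t⋆}` is unbounded
(`Loewner.not_isBounded_hullUnion_of_swallowingTime_le`). Hence `K_∞(ω)` is unbounded on every
path on which `Z(ω)` is continuous, i.e. almost surely; the hypotheses `κ > 0`, `ρ > −2` of the
named fact are not used.
-/

noncomputable section

open Set Filter Topology MeasureTheory Metric
open UpperHalfPlane (upperHalfPlaneSet)
open scoped NNReal
open Literature.Analysis.FunctionSpaces (IsBesselProcess IsSquaredBesselProcess IsStrongSolution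
  IsItoProcess intervalIntegrable_of_forall_integrableOn_Icc)
open Literature.Probability.Process (preWienerMeasure brownian)

namespace Literature.Probability.RandomPlanarGeometry

namespace Loewner

/-! ### Two obstructions to the continuation of a Loewner solution (no continuity of the driver)

The second one rests on the tree's `IsSolution.im_sq_sub_le` (`ObservableShortTime`): along any
solution `(im g_t)² ≥ (im z)² − 4t`, whatever the driving function. -/

section Flow

variable {W : ℝ≥0 → ℝ} {z : ℂ} {g : ℝ → ℂ} {T : WithTop ℝ≥0}

/-- **A driving function escaping to infinity kills the flow.** If `|W s| → ∞` as `s ↑ t₀`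
(`t₀ > 0`), then no solution of the Loewner equation lives past `t₀`: its velocity
`2/(g s − W s)` would tend to `0` as `s ↑ t₀`, so (one-sided extension of derivatives,
`hasDerivWithinAt_Iic_of_tendsto_deriv`) `ġ(t₀) = 0`, whereas `ġ(t₀) = 2/(g t₀ − W t₀) ≠ 0`.
[folklore] -/
theorem IsSolution.not_coe_lt_of_tendsto_abs_driving (h : IsSolution W z g T) {t₀ : ℝ≥0}
    (ht₀ : 0 < t₀) (hW : Tendsto (fun s : ℝ ↦ |W s.toNNReal|) (𝓝[<] (t₀ : ℝ)) atTop) :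
    ¬ (t₀ : WithTop ℝ≥0) < T := by
  intro hT
  have ht₀' : (0 : ℝ) < t₀ := by exact_mod_cast ht₀
  have ht₀T : (((t₀ : ℝ).toNNReal : ℝ≥0) : WithTop ℝ≥0) < T := by simpa using hT
  set D : Set ℝ := {t : ℝ | 0 ≤ t ∧ (t.toNNReal : WithTop ℝ≥0) < T} with hD
  have hd : HasDerivAt g (vectorField W t₀ (g t₀)) t₀ := h.hasDerivAt ht₀' ht₀T
  -- the solution on `s = (0, t₀)`
  set s : Set ℝ := Ioo 0 (t₀ : ℝ) with hs
  have hsD : s ⊆ D := fun u hu ↦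
    Icc_subset_timeDomain ht₀T ⟨hu.1.le, hu.2.le⟩
  have hdiff : DifferentiableOn ℝ g s := fun u hu ↦
    ((h.isIntegralCurveOn u (hsD hu)).differentiableWithinAt).mono hsD
  have hcont : ContinuousWithinAt g s t₀ := hd.continuousAt.continuousWithinAt
  have hsmem : s ∈ 𝓝[<] (t₀ : ℝ) := Ioo_mem_nhdsLT ht₀'
  have hderiv : ∀ u ∈ s, deriv g u = vectorField W u (g u) := fun u hu ↦
    (h.hasDerivAt hu.1 (hsD hu).2).deriv
  -- `g` is bounded near `t₀`, so `|g u - W u| → ∞` and the velocity tends to `0`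
  have hgb : ∀ᶠ u in 𝓝[<] (t₀ : ℝ), ‖g u‖ ≤ ‖g t₀‖ + 1 := by
    have h1 : Tendsto g (𝓝[<] (t₀ : ℝ)) (𝓝 (g t₀)) :=
      hd.continuousAt.tendsto.mono_left nhdsWithin_le_nhds
    have h2 := h1.norm
    filter_upwards [h2.eventually (Iio_mem_nhds (lt_add_one ‖g t₀‖))] with u hu
    exact hu.le
  have hnorm : Tendsto (fun u : ℝ ↦ ‖g u - (W u.toNNReal : ℂ)‖) (𝓝[<] (t₀ : ℝ)) atTop := by
    have h1 : Tendsto (fun u : ℝ ↦ |W u.toNNReal| + -(‖g t₀‖ + 1)) (𝓝[<] (t₀ : ℝ)) atTop :=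
      tendsto_atTop_add_const_right _ _ hW
    refine tendsto_atTop_mono' _ ?_ h1
    filter_upwards [hgb] with u hu
    have : |W u.toNNReal| = ‖(W u.toNNReal : ℂ)‖ := by
      rw [Complex.norm_real, Real.norm_eq_abs]
    rw [this]
    have h3 : ‖(W u.toNNReal : ℂ)‖ ≤ ‖g u - (W u.toNNReal : ℂ)‖ + ‖g u‖ := by
      calc ‖(W u.toNNReal : ℂ)‖ = ‖g u - (g u - (W u.toNNReal : ℂ))‖ := by ring_nf
        _ ≤ ‖g u‖ + ‖g u - (W u.toNNReal : ℂ)‖ := norm_sub_le _ _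
        _ = _ := add_comm _ _
    linarith
  have hlim : Tendsto (fun u ↦ deriv g u) (𝓝[<] (t₀ : ℝ)) (𝓝 0) := by
    have h1 : Tendsto (fun u : ℝ ↦ vectorField W u (g u)) (𝓝[<] (t₀ : ℝ)) (𝓝 0) := by
      rw [tendsto_zero_iff_norm_tendsto_zero]
      have h2 : Tendsto (fun u : ℝ ↦ (2 : ℝ) / ‖g u - (W u.toNNReal : ℂ)‖) (𝓝[<] (t₀ : ℝ))
          (𝓝 0) := tendsto_const_nhds.div_atTop hnorm
      refine h2.congr fun u ↦ ?_
      rw [vectorField_apply, norm_div, Complex.norm_two]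
    refine h1.congr' ?_
    filter_upwards [hsmem] with u hu
    exact (hderiv u hu).symm
  have hleft : HasDerivWithinAt g 0 (Iic (t₀ : ℝ)) t₀ :=
    hasDerivWithinAt_Iic_of_tendsto_deriv hdiff hcont hsmem hlim
  have heq : vectorField W t₀ (g t₀) = 0 :=
    (uniqueDiffWithinAt_Iic (t₀ : ℝ)).eq_deriv _ hd.hasDerivWithinAt hleft
  rw [vectorField_apply, div_eq_zero_iff] at heq
  rcases heq with h2 | h0
  · norm_num at h2
  · exact h.ne ht₀'.le ht₀T (sub_eq_zero.1 h0)

/-- **A jump of the driving function from the right kills the flow of high points.** If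
`W s → w` as `s ↓ t₀` with `w ≠ W t₀`, then no solution of the Loewner equation started at `z`
with `(im z)² > 4t₀` lives past `t₀`: by `IsSolution.im_sq_sub_le` the solution is off the
real line at `t₀`, so its velocity tends to `2/(g t₀ − w)` as `s ↓ t₀`, which (one-sided
extension of derivatives, `hasDerivWithinAt_Ici_of_tendsto_deriv`) would have to be
`ġ(t₀) = 2/(g t₀ − W t₀)`. [folklore] -/
theorem IsSolution.not_coe_lt_of_tendsto_driving (h : IsSolution W z g T) {t₀ : ℝ≥0} {w : ℝ}
    (hW : Tendsto (fun s : ℝ ↦ W s.toNNReal) (𝓝[>] (t₀ : ℝ)) (𝓝 w)) (hw : w ≠ W t₀)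
    (hz : 4 * (t₀ : ℝ) < z.im ^ 2) : ¬ (t₀ : WithTop ℝ≥0) < T := by
  intro hT
  have ht₀0 : (0 : ℝ) ≤ t₀ := t₀.coe_nonneg
  have ht₀T : (((t₀ : ℝ).toNNReal : ℝ≥0) : WithTop ℝ≥0) < T := by simpa using hT
  set D : Set ℝ := {t : ℝ | 0 ≤ t ∧ (t.toNNReal : WithTop ℝ≥0) < T} with hD
  have ht₀D : (t₀ : ℝ) ∈ D := ⟨ht₀0, ht₀T⟩
  -- the solution is off the real line at `t₀`
  have him : (g t₀).im ≠ 0 := by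
    have h1 := h.im_sq_sub_le ht₀0 ht₀T
    intro h0
    rw [h0] at h1
    linarith
  have hne : g t₀ - (w : ℂ) ≠ 0 := by
    intro h0
    apply him
    rw [sub_eq_zero.1 h0, Complex.ofReal_im]
  -- the solution to the right of `t₀`
  set s : Set ℝ := {u : ℝ | (t₀ : ℝ) < u ∧ (u.toNNReal : WithTop ℝ≥0) < T} with hs
  have hsD : s ⊆ D := fun u hu ↦ ⟨ht₀0.trans hu.1.le, hu.2⟩
  have hsmem : s ∈ 𝓝[>] (t₀ : ℝ) :=
    inter_mem self_mem_nhdsWithin (mem_nhdsWithin_of_mem_nhds (setOf_toNNReal_lt_mem_nhds ht₀T))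
  have hDmem : D ∈ 𝓝[Ici (t₀ : ℝ)] (t₀ : ℝ) :=
    mem_of_superset (inter_mem_nhdsWithin _ (setOf_toNNReal_lt_mem_nhds ht₀T))
      fun u hu ↦ ⟨ht₀0.trans hu.1, hu.2⟩
  have hd : HasDerivWithinAt g (vectorField W t₀ (g t₀)) (Ici (t₀ : ℝ)) t₀ :=
    (h.isIntegralCurveOn _ ht₀D).mono_of_mem_nhdsWithin hDmem
  have hdiff : DifferentiableOn ℝ g s := fun u hu ↦
    ((h.isIntegralCurveOn u (hsD hu)).differentiableWithinAt).mono hsD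
  have hcontD : ContinuousWithinAt g D t₀ := (h.isIntegralCurveOn _ ht₀D).continuousWithinAt
  have hcont : ContinuousWithinAt g s t₀ := hcontD.mono hsD
  have hderiv : ∀ u ∈ s, deriv g u = vectorField W u (g u) := fun u hu ↦
    (h.hasDerivAt (ht₀0.trans_lt hu.1) hu.2).deriv
  -- the velocity tends to `2/(g t₀ - w)` from the right
  have hg : Tendsto g (𝓝[>] (t₀ : ℝ)) (𝓝 (g t₀)) :=
    (hcont.mono_of_mem_nhdsWithin hsmem).tendsto
  have hlim : Tendsto (fun u ↦ deriv g u) (𝓝[>] (t₀ : ℝ)) (𝓝 (2 / (g t₀ - w))) := by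
    have h1 : Tendsto (fun u : ℝ ↦ vectorField W u (g u)) (𝓝[>] (t₀ : ℝ))
        (𝓝 (2 / (g t₀ - w))) := by
      have h2 : Tendsto (fun u : ℝ ↦ (W u.toNNReal : ℂ)) (𝓝[>] (t₀ : ℝ)) (𝓝 (w : ℂ)) :=
        (Complex.continuous_ofReal.tendsto w).comp hW
      have h3 := tendsto_const_nhds.div (hg.sub h2) hne (a := (2 : ℂ))
      exact h3.congr fun u ↦ (vectorField_apply W u (g u)).symm
    refine h1.congr' ?_
    filter_upwards [hsmem] with u hu
    exact (hderiv u hu).symm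
  have hright : HasDerivWithinAt g (2 / (g t₀ - w)) (Ici (t₀ : ℝ)) t₀ :=
    hasDerivWithinAt_Ici_of_tendsto_deriv hdiff hcont hsmem hlim
  have heq : vectorField W t₀ (g t₀) = 2 / (g t₀ - w) :=
    (uniqueDiffWithinAt_Ici (t₀ : ℝ)).eq_deriv _ hd hright
  have hne' : g t₀ - (W t₀ : ℂ) ≠ 0 := by
    have := h.ne ht₀0 ht₀T
    simp only [Real.toNNReal_coe] at this
    exact sub_ne_zero.2 this
  rw [vectorField_apply, Real.toNNReal_coe, div_eq_div_iff hne' hne] at heq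
  have h2 : g t₀ - (w : ℂ) = g t₀ - (W t₀ : ℂ) := mul_left_cancel₀ two_ne_zero heq
  apply hw
  have h3 : (w : ℂ) = (W t₀ : ℂ) := by
    have := congrArg (fun x ↦ g t₀ - x) h2
    simpa using this
  exact_mod_cast h3

end Flow

/-! ### Unboundedness of `K_∞` from the swallowing of all high points -/

/-- If every point `z ∈ ℍ` with `(im z)² > 4t₀` is swallowed by time `t₀`, then `K_∞ ⊇ K_{t₀}`
is unbounded. [folklore] -/
theorem not_isBounded_hullUnion_of_swallowingTime_le {U : ℝ≥0 → ℝ} {t₀ : ℝ≥0}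
    (h : ∀ z : ℂ, 0 < z.im → 4 * (t₀ : ℝ) < z.im ^ 2 → swallowingTime U z ≤ t₀) :
    ¬ Bornology.IsBounded (hullUnion U) := by
  intro hb
  obtain ⟨R, hR⟩ := hb.subset_closedBall 0
  set y : ℝ := max R 0 + 4 * t₀ + 1 with hy
  have hR0 : 0 ≤ max R 0 := le_max_right _ _
  have ht₀ : (0 : ℝ) ≤ t₀ := t₀.coe_nonneg
  have hy0 : 0 < y := by positivity
  have hy1 : 1 ≤ y := by linarith [mul_nonneg (show (0 : ℝ) ≤ 4 by norm_num) ht₀]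
  have hyt : 4 * (t₀ : ℝ) < y := by linarith
  have hsq : 4 * (t₀ : ℝ) < y ^ 2 := hyt.trans_le (by nlinarith)
  have him : (Complex.I * y).im = y := by simp
  have hmem : Complex.I * y ∈ hullUnion U := by
    refine mem_iUnion.2 ⟨t₀, ?_, ?_⟩
    · show 0 < (Complex.I * y).im
      rwa [him]
    · exact h _ (by rwa [him]) (by rwa [him])
  have := hR hmem
  rw [mem_closedBall, dist_zero_right, norm_mul, Complex.norm_I, one_mul, Complex.norm_real,
    Real.norm_eq_abs, abs_of_pos hy0] at this
  linarith [le_max_left R 0]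

/-- If no solution from the high points lives past `t₀`, all high points are swallowed by `t₀`.
[folklore] -/
theorem swallowingTime_le_of_forall_not_lt {U : ℝ≥0 → ℝ} {t₀ : ℝ≥0} {z : ℂ}
    (h : ∀ g T, IsSolution U z g T → ¬ (t₀ : WithTop ℝ≥0) < T) : swallowingTime U z ≤ t₀ :=
  sSup_le fun _ ⟨g, hg⟩ ↦ not_lt.1 (h g _ hg)

/-! ### A nonnegative function and the primitive `s ↦ ∫_{(0, s]} f` near a non-integrability time -/

/-- If `f ≥ 0` is integrable on `(0, s]` for every `s < b` but not on `(0, b]` (`b > 0`), then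
`∫_{(0,s]} f → +∞` as `s ↑ b` (otherwise the integrals over `(0, sₙ]`, `sₙ ↑ b`, would be
bounded and `f` integrable on `(0, b]`, `integrableOn_Ioc_of_intervalIntegral_norm_bounded_right`).
[folklore] -/
theorem tendsto_setIntegral_Ioc_atTop {f : ℝ → ℝ} (hf : ∀ u, 0 ≤ f u) {b : ℝ} (hb : 0 < b)
    (hint : ∀ s < b, IntegrableOn f (Ioc 0 s)) (hnot : ¬ IntegrableOn f (Ioc 0 b)) :
    Tendsto (fun s ↦ ∫ u in Ioc 0 s, f u) (𝓝[<] b) atTop := by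
  have hunb : ∀ M : ℝ, ∃ s ∈ Ioo 0 b, M < ∫ u in Ioc 0 s, f u := by
    by_contra hcon
    push Not at hcon
    obtain ⟨M, hM⟩ := hcon
    obtain ⟨a, -, hamem, hat⟩ := exists_seq_strictMono_tendsto' hb
    refine hnot (integrableOn_Ioc_of_intervalIntegral_norm_bounded_right (I := M) (l := atTop)
      (fun i ↦ hint _ (hamem i).2) hat ?_)
    refine Eventually.of_forall fun i ↦ ?_
    have : (∫ x in Ioc 0 (a i), ‖f x‖) = ∫ x in Ioc 0 (a i), f x :=
      setIntegral_congr_fun measurableSet_Ioc fun x _ ↦ by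
        rw [Real.norm_eq_abs, abs_of_nonneg (hf x)]
    rw [this]
    exact hM _ (hamem i)
  rw [Filter.tendsto_atTop]
  intro M
  obtain ⟨s, hs, hMs⟩ := hunb M
  filter_upwards [Ioo_mem_nhdsLT hs.2] with u hu
  refine hMs.le.trans (setIntegral_mono_set (hint u hu.2) ?_ ?_)
  · exact ae_of_all _ fun x ↦ hf x
  · exact (Ioc_subset_Ioc_right hu.1.le).eventuallyLE

end Loewner

/-! ### [LSW] Lemma 8.3 (4), discharged -/

open Loewner in
/-- **[LSW] Lemma 8.3 (4): `K_∞` is a.s. unbounded** — the named fact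
`SLEKappaRho.not_isBounded_hullUnion`, PROVED. On a sample path on which the squared Bessel
process `Z` of the construction is continuous (almost every path: `Z` is an Itô process), write
`f = 1/(√κ √Z) ≥ 0` and `O_t = −2 ∫₀ᵗ f` (interval integral). If `f` is integrable on every
`[0, t]`, the driving function `W = √κ √Z + O` is continuous and the tree's capacity argument
applies (`Loewner.not_isBounded_iUnion_hull`: "One could also use the fact that the half-plane
capacity of `K_t` is `2t`"). Otherwise let `t⋆` be the first time from which on it is not;
`O = 0` after `t⋆` (junk value of the interval integral), and either `∫₀ˢ f ↑ ∞` as `s ↑ t⋆`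
(then no Loewner solution lives past `t⋆`, `IsSolution.not_coe_lt_of_tendsto_abs_driving`), or
`∫₀^{t⋆} f = 0` (then `O ≡ 0` and `W` is continuous again), or `W` jumps by `2∫₀^{t⋆} f > 0`
to the right of `t⋆` (then no solution from a point `z` with `(im z)² > 4t⋆` lives past `t⋆`,
`IsSolution.not_coe_lt_of_tendsto_driving`); in the two degenerate cases `K_{t⋆}` contains
every high point of `ℍ` and is unbounded (`not_isBounded_hullUnion_of_swallowingTime_le`).
[cite: LawlerSchrammWerner2003Restriction, Lemma 8.3 (4) and its proof (p. 36)] -/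
theorem SLEKappaRho.not_isBounded_hullUnion_holds : SLEKappaRho.not_isBounded_hullUnion := by
  intro κ ρ O W _ _ hOW
  obtain ⟨X, hX, hO, hW⟩ := hOW
  have hXnn : ∀ t ω, 0 ≤ X t ω := hX.nonneg
  obtain ⟨Z, hZ, hXZ⟩ := hX
  have hZc := (IsStrongSolution.isItoProcess hZ).ae_continuous
  filter_upwards [hZc] with ω hZω
  -- the sample path: `X(ω)` is continuous, `f = 1/(√κ X(ω)) ≥ 0` is measurable
  have hXc : Continuous fun t ↦ X t ω := by
    have : (fun t ↦ X t ω) = fun t ↦ Real.sqrt (Z t ω) := funext fun t ↦ hXZ t ω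
    rw [this]
    exact Real.continuous_sqrt.comp hZω
  set f : ℝ → ℝ := fun u ↦ (Real.sqrt κ * X u.toNNReal ω)⁻¹ with hf
  have hf0 : ∀ u, 0 ≤ f u := fun u ↦
    inv_nonneg.2 (mul_nonneg (Real.sqrt_nonneg _) (hXnn _ _))
  have hfc : Continuous fun u : ℝ ↦ Real.sqrt κ * X u.toNNReal ω :=
    continuous_const.mul (hXc.comp continuous_real_toNNReal)
  have hfneg : ∀ s ≤ 0, f s = f 0 := fun s hs ↦ by
    simp [hf, Real.toNNReal_of_nonpos hs]
  -- the driving function of the sample path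
  set U : ℝ≥0 → ℝ := fun t ↦ W t ω with hU
  have hUt : ∀ t, U t = Real.sqrt κ * X t ω + -2 * ∫ u in (0 : ℝ)..(t : ℝ), f u := fun t ↦ by
    show W t ω = _
    rw [hW t ω, hO t ω]
  -- local integrability of `f` makes `U` continuous
  have hcontU : (∀ t : ℝ≥0, IntegrableOn f (Ioc 0 (t : ℝ))) → Continuous U := by
    intro hint
    have hii : ∀ a c, IntervalIntegrable f volume a c :=
      intervalIntegrable_of_forall_integrableOn_Icc hfneg
        (fun t ↦ Iff.mpr integrableOn_Icc_iff_integrableOn_Ioc (hint t))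
    have hF : Continuous fun t : ℝ≥0 ↦ ∫ u in (0 : ℝ)..(t : ℝ), f u :=
      (intervalIntegral.continuous_primitive hii 0).comp NNReal.continuous_coe
    have : U = fun t ↦ Real.sqrt κ * X t ω + -2 * ∫ u in (0 : ℝ)..(t : ℝ), f u := funext hUt
    rw [this]
    exact (continuous_const.mul hXc).add (continuous_const.mul hF)
  by_cases hA : ∀ t : ℝ≥0, IntegrableOn f (Ioc 0 (t : ℝ))
  · exact not_isBounded_iUnion_hull (hcontU hA)
  -- otherwise: the first time `t⋆` from which on `f` is not integrable on `(0, t]`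
  push Not at hA
  set B : Set ℝ≥0 := {t | ¬ IntegrableOn f (Ioc 0 (t : ℝ))} with hB
  have hBne : B.Nonempty := hA
  set tstar : ℝ≥0 := sInf B with htstar
  have hbad_mono : ∀ {s t : ℝ≥0}, s ≤ t → s ∈ B → t ∈ B := fun hst hs ht ↦
    hs (ht.mono_set (Ioc_subset_Ioc_right (NNReal.coe_le_coe.2 hst)))
  have hbad_of_gt : ∀ {t : ℝ≥0}, tstar < t → t ∈ B := fun ht ↦ by
    obtain ⟨s, hsB, hst⟩ := exists_lt_of_csInf_lt hBne ht
    exact hbad_mono hst.le hsB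
  have hgood_of_lt : ∀ {t : ℝ≥0}, t < tstar → IntegrableOn f (Ioc 0 (t : ℝ)) := fun ht ↦ by
    by_contra hcon
    exact absurd (csInf_le (OrderBot.bddBelow B) hcon) (not_le.2 ht)
  have h0good : IntegrableOn f (Ioc 0 ((0 : ℝ≥0) : ℝ)) := by
    rw [NNReal.coe_zero, Ioc_self]
    exact integrableOn_empty
  -- the interval integral vanishes (junk value) after `t⋆`
  have hF_gt : ∀ {t : ℝ≥0}, tstar < t → ∫ u in (0 : ℝ)..(t : ℝ), f u = 0 := fun {t} ht ↦
    intervalIntegral.integral_undef fun hii ↦ hbad_of_gt ht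
      ((intervalIntegrable_iff_integrableOn_Ioc_of_le t.coe_nonneg).1 hii)
  -- `√κ X(ω)` read at real times is continuous at `t⋆` from both sides
  have hXlim : ∀ F : Filter ℝ, F ≤ 𝓝 (tstar : ℝ) →
      Tendsto (fun s : ℝ ↦ Real.sqrt κ * X s.toNNReal ω) F (𝓝 (Real.sqrt κ * X tstar ω)) := by
    intro F hF
    have := (hfc.tendsto (tstar : ℝ)).mono_left hF
    simpa using this
  -- the key alternative: `U` is continuous, or all high points are swallowed by some time
  have key : Continuous U ∨
      ∃ t₀ : ℝ≥0, ∀ z : ℂ, 0 < z.im → 4 * (t₀ : ℝ) < z.im ^ 2 → swallowingTime U z ≤ t₀ := by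
    by_cases hstar : tstar ∈ B
    · -- `f` is not integrable on `(0, t⋆]`: blow-up of the driving function at `t⋆−`
      right
      have hpos : 0 < tstar := by
        refine pos_iff_ne_zero.2 fun h0 ↦ ?_
        rw [h0] at hstar
        exact hstar h0good
      have hpos' : (0 : ℝ) < tstar := by exact_mod_cast hpos
      refine ⟨tstar, fun z _ _ ↦ swallowingTime_le_of_forall_not_lt fun g T hg ↦ ?_⟩
      refine hg.not_coe_lt_of_tendsto_abs_driving hpos ?_
      have hI : Tendsto (fun s : ℝ ↦ ∫ u in Ioc 0 s, f u) (𝓝[<] (tstar : ℝ)) atTop := by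
        refine tendsto_setIntegral_Ioc_atTop hf0 hpos' (fun s hs ↦ ?_) hstar
        rcases le_or_gt s 0 with hs0 | hs0
        · rw [Ioc_eq_empty (not_lt.2 hs0)]
          exact integrableOn_empty
        · have h1 : s.toNNReal < tstar := by
            rw [← NNReal.coe_lt_coe, Real.coe_toNNReal _ hs0.le]
            exact hs
          have h2 := hgood_of_lt h1
          rwa [Real.coe_toNNReal _ hs0.le] at h2
      have hU' : ∀ᶠ s in 𝓝[<] (tstar : ℝ),
          Real.sqrt κ * X s.toNNReal ω + -2 * ∫ u in Ioc 0 s, f u = U s.toNNReal := by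
        filter_upwards [Ioo_mem_nhdsLT hpos'] with s hs
        rw [hUt, Real.coe_toNNReal _ hs.1.le, intervalIntegral.integral_of_le hs.1.le]
      have hlim : Tendsto (fun s : ℝ ↦ U s.toNNReal) (𝓝[<] (tstar : ℝ)) atBot :=
        ((hXlim _ nhdsWithin_le_nhds).add_atBot (hI.const_mul_atTop_of_neg (by norm_num))).congr'
          hU'
      exact tendsto_abs_atBot_atTop.comp hlim
    · have hgood : IntegrableOn f (Ioc 0 (tstar : ℝ)) := not_not.1 hstar
      by_cases hI0 : ∫ u in Ioc 0 (tstar : ℝ), f u = 0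
      · -- `∫₀^{t⋆} f = 0`: the interval integral vanishes identically, `U = √κ X(ω)`
        left
        have hFz : ∀ t : ℝ≥0, ∫ u in (0 : ℝ)..(t : ℝ), f u = 0 := by
          intro t
          rcases lt_or_ge tstar t with ht | ht
          · exact hF_gt ht
          · rw [intervalIntegral.integral_of_le t.coe_nonneg]
            refine le_antisymm ?_ (setIntegral_nonneg measurableSet_Ioc fun u _ ↦ hf0 u)
            refine (setIntegral_mono_set hgood (ae_of_all _ fun u ↦ hf0 u) ?_).trans_eq hI0
            exact (Ioc_subset_Ioc_right (NNReal.coe_le_coe.2 ht)).eventuallyLE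
        have : U = fun t ↦ Real.sqrt κ * X t ω := by
          funext t
          rw [hUt, hFz]
          ring
        rw [this]
        exact continuous_const.mul hXc
      · -- `∫₀^{t⋆} f > 0`: jump of the driving function at `t⋆+`
        right
        refine ⟨tstar, fun z _ hz4 ↦ swallowingTime_le_of_forall_not_lt fun g T hg ↦ ?_⟩
        refine hg.not_coe_lt_of_tendsto_driving (w := Real.sqrt κ * X tstar ω) ?_ ?_ hz4
        · refine (hXlim _ nhdsWithin_le_nhds).congr' ?_
          filter_upwards [self_mem_nhdsWithin] with s hs
          have hs' : tstar < s.toNNReal := Real.lt_toNNReal_iff_coe_lt.2 hs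
          rw [hUt, hF_gt hs']
          ring
        · rw [hUt, intervalIntegral.integral_of_le tstar.coe_nonneg]
          intro heq
          apply hI0
          linarith
  rcases key with hc | ⟨t₀, ht₀⟩
  · exact not_isBounded_iUnion_hull hc
  · exact not_isBounded_hullUnion_of_swallowingTime_le ht₀

end Literature.Probability.RandomPlanarGeometry

end
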